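import Mathlib
import Summits.NavierStokesRegularity.NavierStokesRegularity.Theorems.SubOnsagerCeilingKPPairSlaving
import Summits.NavierStokesRegularity.NavierStokesRegularity.Theorems.SubOnsagerCeilingKPPairSlavingStructural
import HarnessLib

/-!
# Pair slaving from NEIGHBOUR ENVELOPES — the plug-and-play form
(helper file for crux stmt-NavierStokesRegularity-27057 `SubOnsagerCeiling.ForwardTailCeilingKP`,
`--supports … --as helper`; assembles `SubOnsagerCeilingKPPairSlaving` (p646904) with
`SubOnsagerCeilingKPPairSlavingStructural` (p647152))

`kpProper_source_envelope`: for a KP network proper (symmetric, cancelling, orthant, diagonal feeds), an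
honest `ν`-viscous solution `X` on `[0,T]` that is non-negative on the shells `n, n+1` and a feed
`a → e` (`w = α a a e (0,0,1) > 0`, `λ = w(1+ε₀)^{5n/2}`), ENVELOPES of the neighbours —
`|X_{j,n-1}| ≤ B₀ j`, `X_{j,n} ≤ B₁ j`, `X_{j,n+1} ≤ B₂ j`, `X_{j,n+2} ≤ B₃ j` on `[0,T]` — give the two
constants of the pair lemma explicitly,

  `I₀ = (1+ε₀)^{5(n-1)/2} Σ_j w_{ja} (B₀ j)² + (1+ε₀)^{5n/2} Σ_{i₁,i₂} |α i₁ i₂ a (0,0,0)| B₁ i₁ B₁ i₂`,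
  `ρ₀ = (1+ε₀)^{5(n+1)/2} (Σ_j w_{ej} B₃ j + Σ_j P_{e→j} B₂ j) + ν(1+ε₀)^{2(n+1)}`,

and hence `X_{a,n} < S` on `[0,T]` for every `S` with `X_{a,n}(0) ≤ S/2` and `24 I₀² + 8 I₀ ρ₀ S < 7 λ² S⁴`.
This is the form in which an induction over shells / over the exit graph consumes the lemma: envelopes of
the feeders of `a` and of the partners of `e` in, envelope of `a` out, ν-uniformly (ν only enlarges `ρ₀`,
entering `S` through `(I₀ρ₀)^{1/3}λ^{-2/3}`).

HONEST FRAMING: an inequality about Tao-type MODEL lattice tables (rung TL-M2Break, route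
SubOnsagerCeiling); an ingredient of, not a proof of, the crux; nothing here bears on Navier–Stokes.
-/

noncomputable section

-- the sub-problem namespace `NavierStokesRegularity.NavierStokesRegularity` is the tree's layout (D-0017)
set_option linter.dupNamespace false

namespace Summit.NavierStokesRegularity.NavierStokesRegularity.Theorems

open Set Finset
open Literature.Analysis.FluidPDE.TaoCascade

/-- **PAIR SLAVING FROM NEIGHBOUR ENVELOPES.**  See the module docstring: envelopes of the feeders of the
source `a` (shells `n-1`, `n`) and of the partners of its target `e` (shells `n+1`, `n+2`) along an honest
non-negative `ν`-viscous solution of a KP network proper bound the source `X_{a,n}` by every `S` beyond the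
pair scale `max((I₀ρ₀)^{1/3}λ^{-2/3}, (I₀/λ)^{1/2})` (precisely: `24 I₀² + 8 I₀ ρ₀ S < 7 λ² S⁴`) from which it
starts below `S/2`. MODEL lattice statement. [this file] -/
theorem kpProper_source_envelope {ε₀ ν T S : ℝ} {α : Fin 4 → Fin 4 → Fin 4 → ℤ × ℤ × ℤ → ℝ}
    {X : Fin 4 → ℤ → ℝ → ℝ} (hs : IsSymmetricCoeff α) (hc : IsCancellingCoeff α)
    (hO : ∀ (Y : Fin 4 → ℤ → ℝ → ℝ) (τ : ℝ), (∀ (j : Fin 4) (k : ℤ), 1 ≤ k → 0 ≤ Y j k τ) →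
      ∀ δ : ℝ, 0 < δ → ∀ (i : Fin 4) (n : ℤ), 1 ≤ n → Y i n τ = 0 → 0 ≤ quadTerm δ α Y i n τ)
    (hD : ∀ a b i : Fin 4, a ≠ b → α a b i (0, 0, 1) = 0)
    (hε : 0 < ε₀) (hν : 0 ≤ ν) (a e : Fin 4) (n : ℤ) (hw : 0 < α a a e (0, 0, 1)) (hS : 0 < S)
    (hXa : ∀ t ∈ Icc 0 T, HasDerivWithinAt (X a n)
      (quadTerm ε₀ α X a n t - ν * (1 + ε₀) ^ ((2 : ℝ) * n) * X a n t) (Icc 0 T) t)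
    (hXe : ∀ t ∈ Icc 0 T, HasDerivWithinAt (X e (n + 1))
      (quadTerm ε₀ α X e (n + 1) t - ν * (1 + ε₀) ^ ((2 : ℝ) * (((n + 1 : ℤ)) : ℝ)) * X e (n + 1) t)
        (Icc 0 T) t)
    {B₀ B₁ B₂ B₃ : Fin 4 → ℝ}
    (hB₀ : ∀ t ∈ Icc 0 T, ∀ j, |X j (n - 1) t| ≤ B₀ j)
    (hB₁ : ∀ t ∈ Icc 0 T, ∀ j, 0 ≤ X j n t ∧ X j n t ≤ B₁ j)
    (hB₂ : ∀ t ∈ Icc 0 T, ∀ j, 0 ≤ X j (n + 1) t ∧ X j (n + 1) t ≤ B₂ j)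
    (hB₃ : ∀ t ∈ Icc 0 T, ∀ j, 0 ≤ X j (n + 2) t ∧ X j (n + 2) t ≤ B₃ j)
    (hcond : 24 * ((1 + ε₀) ^ ((5 : ℝ) * ((n : ℝ) - 1) / 2) * ∑ j, α j j a (0, 0, 1) * B₀ j ^ 2 +
          (1 + ε₀) ^ ((5 : ℝ) * n / 2) * ∑ i₁, ∑ i₂, |α i₁ i₂ a (0, 0, 0)| * (B₁ i₁ * B₁ i₂)) ^ 2 +
        8 * ((1 + ε₀) ^ ((5 : ℝ) * ((n : ℝ) - 1) / 2) * ∑ j, α j j a (0, 0, 1) * B₀ j ^ 2 +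
          (1 + ε₀) ^ ((5 : ℝ) * n / 2) * ∑ i₁, ∑ i₂, |α i₁ i₂ a (0, 0, 0)| * (B₁ i₁ * B₁ i₂)) *
          ((1 + ε₀) ^ ((5 : ℝ) * (((n + 1 : ℤ) : ℝ)) / 2) *
              (∑ j, α e e j (0, 0, 1) * B₃ j + ∑ j, α e e j (0, 0, 0) * B₂ j) +
            ν * (1 + ε₀) ^ ((2 : ℝ) * (((n + 1 : ℤ)) : ℝ))) * S <
        7 * (α a a e (0, 0, 1) * (1 + ε₀) ^ ((5 : ℝ) * n / 2)) ^ 2 * S ^ 4)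
    (hinit : X a n 0 ≤ S / 2) :
    ∀ t ∈ Icc 0 T, X a n t < S := by
  have hb : (0 : ℝ) < 1 + ε₀ := by linarith
  by_cases hT : (0 : ℝ) ≤ T
  swap
  · intro t ht; exact absurd (ht.1.trans ht.2) hT
  have h0 : (0 : ℝ) ∈ Icc (0 : ℝ) T := ⟨le_rfl, hT⟩
  set Lm : ℝ := (1 + ε₀) ^ ((5 : ℝ) * ((n : ℝ) - 1) / 2) with hLm
  set L0 : ℝ := (1 + ε₀) ^ ((5 : ℝ) * n / 2) with hL0
  set L1 : ℝ := (1 + ε₀) ^ ((5 : ℝ) * (((n + 1 : ℤ) : ℝ)) / 2) with hL1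
  have hLm0 : 0 < Lm := Real.rpow_pos_of_pos hb _
  have hL00 : 0 < L0 := Real.rpow_pos_of_pos hb _
  have hL10 : 0 < L1 := Real.rpow_pos_of_pos hb _
  set I₀ : ℝ := Lm * ∑ j, α j j a (0, 0, 1) * B₀ j ^ 2 +
    L0 * ∑ i₁, ∑ i₂, |α i₁ i₂ a (0, 0, 0)| * (B₁ i₁ * B₁ i₂) with hI₀
  set ρ₀ : ℝ := L1 * (∑ j, α e e j (0, 0, 1) * B₃ j + ∑ j, α e e j (0, 0, 0) * B₂ j) with hρ₀
  have hB1nn : ∀ j, 0 ≤ B₁ j := fun j => (hB₁ 0 h0 j).1.trans (hB₁ 0 h0 j).2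
  have hB2nn : ∀ j, 0 ≤ B₂ j := fun j => (hB₂ 0 h0 j).1.trans (hB₂ 0 h0 j).2
  have hB3nn : ∀ j, 0 ≤ B₃ j := fun j => (hB₃ 0 h0 j).1.trans (hB₃ 0 h0 j).2
  have hfeed := kpProper_feed_nonneg hO
  have hpump : ∀ j, 0 ≤ α e e j (0, 0, 0) := by
    intro j
    by_cases hje : j = e
    · rw [hje, kpProper_inShell_diag_zero hc e]
    · exact kpProper_pump_nonneg hO hje
  have hI : 0 ≤ I₀ := by
    have h1 : 0 ≤ ∑ j, α j j a (0, 0, 1) * B₀ j ^ 2 :=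
      Finset.sum_nonneg fun j _ => mul_nonneg (hfeed j a) (sq_nonneg _)
    have h2 : 0 ≤ ∑ i₁, ∑ i₂, |α i₁ i₂ a (0, 0, 0)| * (B₁ i₁ * B₁ i₂) :=
      Finset.sum_nonneg fun i₁ _ => Finset.sum_nonneg fun i₂ _ =>
        mul_nonneg (abs_nonneg _) (mul_nonneg (hB1nn i₁) (hB1nn i₂))
    positivity
  have hρ : 0 ≤ ρ₀ := by
    have h1 : 0 ≤ ∑ j, α e e j (0, 0, 1) * B₃ j :=
      Finset.sum_nonneg fun j _ => mul_nonneg (hfeed e j) (hB3nn j)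
    have h2 : 0 ≤ ∑ j, α e e j (0, 0, 0) * B₂ j :=
      Finset.sum_nonneg fun j _ => mul_nonneg (hpump j) (hB2nn j)
    positivity
  refine kpProper_pairSlaving hε hν a e n hXa hXe (fun t ht => (hB₁ t ht a).1)
    (fun t ht => (hB₂ t ht e).1) hw hI hρ hS ?_ ?_ hcond hinit
  · -- the source side: inputs ≤ I₀
    intro t ht
    have h := kpProper_quadTerm_source_le hs hc hO hD hb X a e n t (fun j => (hB₁ t ht j).1)
      (fun j => (hB₂ t ht j).1)
    have h1 : ∑ j, α j j a (0, 0, 1) * X j (n - 1) t ^ 2 ≤ ∑ j, α j j a (0, 0, 1) * B₀ j ^ 2 := by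
      refine Finset.sum_le_sum fun j _ => mul_le_mul_of_nonneg_left ?_ (hfeed j a)
      have hab := abs_le.1 (hB₀ t ht j)
      exact sq_le_sq' hab.1 hab.2
    have h2 : ∑ i₁, ∑ i₂, α i₁ i₂ a (0, 0, 0) *
        (Function.update (fun j => X j n t) a 0 i₁ * Function.update (fun j => X j n t) a 0 i₂) ≤
        ∑ i₁, ∑ i₂, |α i₁ i₂ a (0, 0, 0)| * (B₁ i₁ * B₁ i₂) := by
      have hx : ∀ j, 0 ≤ Function.update (fun j => X j n t) a 0 j ∧
          Function.update (fun j => X j n t) a 0 j ≤ B₁ j := by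
        intro j
        by_cases hja : j = a
        · simp [Function.update, hja, hB1nn a]
        · simp [Function.update, hja, (hB₁ t ht j).1, (hB₁ t ht j).2]
      refine Finset.sum_le_sum fun i₁ _ => Finset.sum_le_sum fun i₂ _ => ?_
      have hp : 0 ≤ Function.update (fun j => X j n t) a 0 i₁ * Function.update (fun j => X j n t) a 0 i₂ :=
        mul_nonneg (hx i₁).1 (hx i₂).1
      have hpB : Function.update (fun j => X j n t) a 0 i₁ * Function.update (fun j => X j n t) a 0 i₂ ≤
          B₁ i₁ * B₁ i₂ := mul_le_mul (hx i₁).2 (hx i₂).2 (hx i₂).1 (hB1nn i₁)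
      calc α i₁ i₂ a (0, 0, 0) * _ ≤ |α i₁ i₂ a (0, 0, 0)| * _ :=
            mul_le_mul_of_nonneg_right (le_abs_self _) hp
        _ ≤ |α i₁ i₂ a (0, 0, 0)| * (B₁ i₁ * B₁ i₂) := mul_le_mul_of_nonneg_left hpB (abs_nonneg _)
    have h1' := mul_le_mul_of_nonneg_left h1 hLm0.le
    have h2' := mul_le_mul_of_nonneg_left h2 hL00.le
    simp only [hI₀]
    linarith
  · -- the target side: drains ≤ ρ₀ · X_e
    intro t ht
    have h := kpProper_quadTerm_target_ge hs hc hO hD hb X a e n t (fun j => (hB₂ t ht j).1)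
    have hXe : 0 ≤ X e (n + 1) t := (hB₂ t ht e).1
    have h1 : ∑ j, α e e j (0, 0, 1) * X j (n + 2) t ≤ ∑ j, α e e j (0, 0, 1) * B₃ j :=
      Finset.sum_le_sum fun j _ => mul_le_mul_of_nonneg_left (hB₃ t ht j).2 (hfeed e j)
    have h2 : ∑ j, α e e j (0, 0, 0) * X j (n + 1) t ≤ ∑ j, α e e j (0, 0, 0) * B₂ j :=
      Finset.sum_le_sum fun j _ => mul_le_mul_of_nonneg_left (hB₂ t ht j).2 (hpump j)
    have h3 : X e (n + 1) t * (L1 * (∑ j, α e e j (0, 0, 1) * X j (n + 2) t +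
        ∑ j, α e e j (0, 0, 0) * X j (n + 1) t)) ≤ X e (n + 1) t * ρ₀ := by
      refine mul_le_mul_of_nonneg_left ?_ hXe
      simp only [hρ₀]
      exact mul_le_mul_of_nonneg_left (by linarith) hL10.le
    linarith

end Summit.NavierStokesRegularity.NavierStokesRegularity.Theorems

end
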